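import Summits.RiemannHypothesis.RiemannHypothesis.Theorems.JensenPolynomialsXiGorttwCoeffSmallTableCheck

/-!
# Route `JensenPolynomials` — TABLE crux, part 3: soundness of the cell checker

`cellSmall_of_checkCell`: if the `d` ratio boxes of a cell's window enclose `γ(m+1)/γ(m)` (`n ≤ m < n+d`), the
table row `R` dominates `rhoHT d ·` (`RValid`), `s² ≤ 2d+1` (`TValid`, so `2/B_d ≤ 1/(s+1)`), `3 ≤ d < 108`, and
`checkCell d R (1/(s+1)) win = true`, then BOTH weighted `ℓ¹` sums of the cell `(d, n)` of
`XiGorttwCoeffSmallBelow rhoWinMin N` are `< 1` — for ANY real sequence `γ`. Chain: window ratios (`wR_succ`) ∈ `wIv`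
boxes → `Δ²` box → `S_k` boxes → `T_j = c_j Δ^j` boxes (part 1 identities) → `|c_j| ≤ U_j/Δ^j` → parity split
`Σ_j U_j w_j/Δ^j ≤ E + O/Δ ≤ E + O/√δ < 1`. RH-FREE, ξ-free. Nothing here bears on the truth of RH.
-/

-- D-0017: `Summit.RiemannHypothesis.RiemannHypothesis.…` duplicates the namespace BY DESIGN (single-problem summit).
set_option linter.dupNamespace false

namespace Summit.RiemannHypothesis.RiemannHypothesis.Theorems.JensenPolynomials.CoeffTable

open Literature.NumberTheory.LFunctions Polynomial Finset
open scoped BigOperators Nat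

/-! ## Table validity predicates (decidable) and what they give -/

/-- `R` dominates the Hermite–Turán table row `rhoHT d ·` (squared conditions, rational). -/
def RValid (d : ℕ) (R : ℕ → ℚ) : Prop :=
  0 ≤ R 1 ∧ 1 / (2 * ((d : ℚ) - 1)) ≤ R 2 ∧
  (0 ≤ R 3 ∧ 2 * (d : ℚ) - 1 ≤ (R 3 * (2 * ((d : ℚ) - 1) * ((d : ℚ) - 2))) ^ 2) ∧
  3 * (d : ℚ) / (4 * ((d : ℚ) - 1) * ((d : ℚ) - 2) * ((d : ℚ) - 3)) ≤ R 4 ∧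
  ∀ j ∈ Finset.Icc 5 d, 0 ≤ R j ∧ ((d - j)! : ℚ) / ((2 : ℚ) ^ j * ((d - 1)! : ℚ)) ≤ R j ^ 2

/-- Decidability (rational arithmetic). -/
instance (d : ℕ) (R : ℕ → ℚ) : Decidable (RValid d R) := by unfold RValid; infer_instance

/-- `s` is a rational lower bound of `√(2d+1)`. -/
def TValid (d : ℕ) (s : ℚ) : Prop := 0 ≤ s ∧ s ^ 2 ≤ 2 * (d : ℚ) + 1

/-- Decidability (rational arithmetic). -/
instance (d : ℕ) (s : ℚ) : Decidable (TValid d s) := by unfold TValid; infer_instance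

/-- A valid table row dominates `rhoHT d ·` on `1 ≤ j ≤ d` and is nonnegative there (`3 ≤ d`). -/
theorem rhoHT_le_of_RValid {d : ℕ} {R : ℕ → ℚ} (hd : 3 ≤ d) (hR : RValid d R) {j : ℕ} (hj1 : 1 ≤ j)
    (hjd : j ≤ d) : rhoHT d j ≤ (R j : ℝ) ∧ (0 : ℝ) ≤ (R j : ℝ) := by
  obtain ⟨h1, h2, ⟨h3a, h3b⟩, h4, h5⟩ := hR
  have hd1 : (0 : ℝ) < (d : ℝ) - 1 := by
    have : (3 : ℝ) ≤ (d : ℝ) := by exact_mod_cast hd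
    linarith
  have hd2 : (0 : ℝ) < (d : ℝ) - 2 := by
    have : (3 : ℝ) ≤ (d : ℝ) := by exact_mod_cast hd
    linarith
  unfold rhoHT
  by_cases hj : j ≤ 1
  · rw [if_pos hj]
    have : j = 1 := by omega
    subst this
    exact ⟨by exact_mod_cast h1, by exact_mod_cast h1⟩
  rw [if_neg hj]
  by_cases hj2 : j = 2
  · subst hj2; rw [if_pos rfl]
    have h2' : (1 : ℝ) / (2 * ((d : ℝ) - 1)) ≤ (R 2 : ℝ) := by exact_mod_cast h2
    exact ⟨h2', le_trans (by positivity) h2'⟩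
  rw [if_neg hj2]
  by_cases hj3 : j = 3
  · subst hj3; rw [if_pos rfl]
    have h3a' : (0 : ℝ) ≤ (R 3 : ℝ) := by exact_mod_cast h3a
    have h3b' : 2 * (d : ℝ) - 1 ≤ ((R 3 : ℝ) * (2 * ((d : ℝ) - 1) * ((d : ℝ) - 2))) ^ 2 := by
      exact_mod_cast h3b
    have hden : (0 : ℝ) < 2 * ((d : ℝ) - 1) * ((d : ℝ) - 2) := by positivity
    refine ⟨?_, h3a'⟩
    rw [div_le_iff₀ hden]
    exact (Real.sqrt_le_sqrt h3b').trans_eq (Real.sqrt_sq (mul_nonneg h3a' hden.le))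
  rw [if_neg hj3]
  by_cases hj4 : j = 4
  · subst hj4; rw [if_pos rfl]
    have hd3 : (0 : ℝ) < (d : ℝ) - 3 := by
      have : (4 : ℝ) ≤ (d : ℝ) := by exact_mod_cast hjd
      linarith
    have h4' : 3 * (d : ℝ) / (4 * ((d : ℝ) - 1) * ((d : ℝ) - 2) * ((d : ℝ) - 3)) ≤ (R 4 : ℝ) := by
      exact_mod_cast h4
    exact ⟨h4', le_trans (by positivity) h4'⟩
  rw [if_neg hj4]
  have hj5 : j ∈ Finset.Icc 5 d := by rw [Finset.mem_Icc]; omega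
  obtain ⟨h5a, h5b⟩ := h5 j hj5
  have h5a' : (0 : ℝ) ≤ (R j : ℝ) := by exact_mod_cast h5a
  have h5b' : ((((d - j)! : ℚ) / ((2 : ℚ) ^ j * ((d - 1)! : ℚ)) : ℚ) : ℝ) ≤ ((R j ^ 2 : ℚ) : ℝ) :=
    Rat.cast_le.mpr h5b
  push_cast at h5b'
  exact ⟨(Real.sqrt_le_sqrt h5b').trans_eq (Real.sqrt_sq h5a'), h5a'⟩

/-- Below `d = 108` the route's table `rhoWinMin` is dominated row-wise by `rhoHT` (window rows cannot fire). -/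
theorem rhoWinMin_le_rhoHT {d : ℕ} (hd : d < 108) (j : ℕ) : rhoWinMin d j ≤ rhoHT d j := by
  unfold rhoWinMin
  by_cases h4 : j ≤ 4
  · rw [if_pos h4]
  · rw [if_neg h4]
    split_ifs with h5 h6 h7
    · exact min_le_left _ _
    · exact min_le_left _ _
    · exfalso
      have hj : 3 ≤ j - 2 := by omega
      have : 27 ≤ (j - 2) ^ 3 := by
        calc 27 = 3 ^ 3 := by norm_num
          _ ≤ (j - 2) ^ 3 := Nat.pow_le_pow_left hj 3
      omega
    · exact le_rfl

/-- `0 ≤ 2/B_d ≤ 1/(s+1)` for a valid `s` (`s² ≤ 2d+1`, `0 ≤ s`). -/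
theorem two_div_testBound_le {d : ℕ} {s : ℚ} (hs : TValid d s) :
    0 ≤ 2 / hermiteTestBound d ∧ 2 / hermiteTestBound d ≤ ((1 / (s + 1) : ℚ) : ℝ) := by
  obtain ⟨hs0, hs2⟩ := hs
  have hs0' : (0 : ℝ) ≤ (s : ℝ) := by exact_mod_cast hs0
  have hsq : (s : ℝ) ≤ Real.sqrt (2 * (d : ℝ) + 1) := by
    rw [Real.le_sqrt hs0' (by positivity)]; exact_mod_cast hs2
  have hB : hermiteTestBound d = 2 * (Real.sqrt (2 * (d : ℝ) + 1) + 1) := by unfold hermiteTestBound; ring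
  have hpos : (0 : ℝ) < Real.sqrt (2 * (d : ℝ) + 1) + 1 := by positivity
  rw [hB]
  refine ⟨by positivity, ?_⟩
  rw [← div_div, div_self (by norm_num : (2 : ℝ) ≠ 0)]
  push_cast
  exact one_div_le_one_div_of_le (by positivity) (by linarith)

/-! ## Lookups in memoised lists -/

/-- Lookup in a memoised `map` over `range`. -/
theorem lk_map_range (f : ℕ → Iv) {N i : ℕ} (h : i < N) : lk ((List.range N).map f) i = f i := by
  simp [lk, List.getD_eq_getElem?_getD, h]

/-- Lookup in a memoised rational `map` over `range`. -/
theorem lk'_map_range (f : ℕ → ℚ) {N i : ℕ} (h : i < N) :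
    checkCell.lk' ((List.range N).map f) i = f i := by
  simp [checkCell.lk', List.getD_eq_getElem?_getD, h]

/-! ## Enclosure of the window ratios, `Δ²`, `S_k`, `T_j` -/

section Cell

variable {γ : ℕ → ℝ} {d n : ℕ} {win : ℕ → Iv}

/-- Window hypothesis: positive lower ends and enclosure of the `d` consecutive ratios. -/
def WinEncl (γ : ℕ → ℝ) (n d : ℕ) (win : ℕ → Iv) : Prop :=
  ∀ t, t < d → 0 < (win t).1 ∧ Mem (γ (n + t + 1) / γ (n + t)) (win t)

/-- An enclosed window with positive lower ends forces `γ(n+t) ≠ 0`, `t ≤ d`. -/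
theorem ne_zero_of_winEncl (h : WinEncl γ n d win) {t : ℕ} (ht : t ≤ d) (hd : 1 ≤ d) : γ (n + t) ≠ 0 := by
  rcases Nat.lt_or_ge t d with hlt | hge
  · obtain ⟨hpos, hlo, -⟩ := h t hlt
    have : γ (n + t + 1) / γ (n + t) ≠ 0 := ne_of_gt (lt_of_lt_of_le (by exact_mod_cast hpos) hlo)
    exact (div_ne_zero_iff.mp this).2
  · have ht' : t = d := le_antisymm ht hge
    subst ht'
    obtain ⟨hpos, hlo, -⟩ := h (t - 1) (by omega)
    have : γ (n + (t - 1) + 1) / γ (n + (t - 1)) ≠ 0 :=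
      ne_of_gt (lt_of_lt_of_le (by exact_mod_cast hpos) hlo)
    rw [show n + (t - 1) + 1 = n + t by omega] at this
    exact (div_ne_zero_iff.mp this).1

/-- Upper ends of an enclosing window are positive. -/
theorem hi_pos_of_winEncl (h : WinEncl γ n d win) {t : ℕ} (ht : t < d) : 0 < (win t).2 := by
  obtain ⟨hpos, hlo, hhi⟩ := h t ht
  have : ((win t).1 : ℝ) ≤ ((win t).2 : ℝ) := hlo.trans hhi
  exact lt_of_lt_of_le hpos (by exact_mod_cast this)

/-- `w_i(M) ∈ W_i` and `0 ≤ W_i.lo`, `i ≤ d`. -/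
theorem wR_mem_wIv (h : WinEncl γ n d win) (hd : 1 ≤ d) :
    ∀ i, i ≤ d → Mem (wR γ (n + d) i) (wIv win d i) ∧ 0 ≤ (wIv win d i).1 := by
  intro i
  induction i with
  | zero =>
    intro _
    rw [wR_zero (ne_zero_of_winEncl h le_rfl hd)]
    exact ⟨by simpa [wIv] using mem_const 1, by simp [wIv]⟩
  | succ i ih =>
    intro hi
    obtain ⟨ihm, ihnn⟩ := ih (by omega)
    have hM := ne_zero_of_winEncl h (le_refl d) hd
    have hM1 : γ (n + d - 1) ≠ 0 := by
      have := ne_zero_of_winEncl h (show d - 1 ≤ d by omega) hd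
      rwa [show n + (d - 1) = n + d - 1 by omega] at this
    have hMi : γ (n + d - i) ≠ 0 := by
      have := ne_zero_of_winEncl h (show d - i ≤ d by omega) hd
      rwa [show n + (d - i) = n + d - i by omega] at this
    have hMi1 : γ (n + d - (i + 1)) ≠ 0 := by
      have := ne_zero_of_winEncl h (show d - (i + 1) ≤ d by omega) hd
      rwa [show n + (d - (i + 1)) = n + d - (i + 1) by omega] at this
    rw [wR_succ hM hM1 hMi hMi1]
    obtain ⟨ha0, ha⟩ := h (d - 1) (by omega)
    obtain ⟨hb0, hb⟩ := h (d - 1 - i) (by omega)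
    rw [show n + (d - 1) + 1 = n + d by omega, show n + (d - 1) = n + d - 1 by omega] at ha
    rw [show n + (d - 1 - i) + 1 = n + d - i by omega, show n + (d - 1 - i) = n + d - (i + 1) by omega] at hb
    refine ⟨mem_divPos (mulPos_fst_nonneg ihnn ha0.le) hb0 (mem_mulPos ihnn ha0.le ihm ha) hb, ?_⟩
    exact divPos_fst_nonneg (mulPos_fst_nonneg ihnn ha0.le) (hi_pos_of_winEncl h (by omega)).le

/-- Lookup in the coefficient table `sTab d`. -/
theorem lkz_sTab {d l k : ℕ} (hl : l ≤ d) (hk : k ≤ d) : lkz (sTab d) l k = sCoef d l k := by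
  have hl' : l < d + 1 := by omega
  have hk' : k < d + 1 := by omega
  simp [lkz, sTab, List.getD_eq_getElem?_getD, hl', hk']

/-- `S_k ∈ sIv` for `k ≤ d`, given a lookup `W` agreeing with `wIv` up to `d`. -/
theorem sR_mem_sIv (h : WinEncl γ n d win) (hd : 1 ≤ d) {W : ℕ → Iv} (hW : ∀ i, i ≤ d → W i = wIv win d i)
    {k : ℕ} (hk : k ≤ d) : Mem (sR γ d n k) (sIv d (sTab d) W k) := by
  unfold sR sIv
  apply mem_ivSum
  intro l hl
  have hld : l ≤ d := Nat.lt_succ_iff.mp (mem_range.mp hl)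
  by_cases hkl : k ≤ l
  · rw [if_pos hkl, if_pos hkl, hW (d - l) (by omega), lkz_sTab hld hk]
    have := mem_scaleInt (sCoef d l k) (wR_mem_wIv h hd (d - l) (by omega)).1
    simpa using this
  · rw [if_neg hkl, if_neg hkl]; simpa using mem_const 0

/-- `Δ² ∈ D` where `D = ((1 − W₂.hi)/2, (1 − W₂.lo)/2)`. -/
theorem deltaSq_mem (h : WinEncl γ n d win) (hd : 2 ≤ d) {W2 : Iv} (hW2 : W2 = wIv win d 2) :
    Mem (gorttwDeltaSq γ (n + d)) ((1 - W2.2) / 2, (1 - W2.1) / 2) := by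
  have hM := ne_zero_of_winEncl h (le_refl d) (by omega)
  obtain ⟨hlo, hhi⟩ := (wR_mem_wIv h (by omega) 2 hd).1
  rw [← hW2] at hlo hhi
  rw [wR_eq_windowSeqDown hM (by norm_num)] at hlo hhi
  unfold gorttwDeltaSq
  constructor <;> push_cast <;> linarith

/-- `(Δ²)^i ∈ dPow D i` and nonnegative lower ends. -/
theorem deltaSq_pow_mem {D : Iv} (hD : 0 ≤ D.1) (hm : Mem (gorttwDeltaSq γ (n + d)) D) :
    ∀ i, Mem (gorttwDeltaSq γ (n + d) ^ i) (dPow D i) ∧ 0 ≤ (dPow D i).1 := by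
  intro i
  induction i with
  | zero => exact ⟨by simpa [dPow] using mem_const 1, by simp [dPow]⟩
  | succ i ih =>
    rw [pow_succ]
    exact ⟨mem_mulPos ih.2 hD ih.1 hm, mulPos_fst_nonneg ih.2 hD⟩

/-- `T_j ∈ tIv` for `j ≤ d`. -/
theorem tR_mem_tIv {S Dp : ℕ → Iv} {D : Iv} (hD : 0 ≤ D.1)
    (hm : Mem (gorttwDeltaSq γ (n + d)) D)
    (hS : ∀ k, k ≤ d → Mem (sR γ d n k) (S k)) (hDp : ∀ i, i ≤ d / 2 → Dp i = dPow D i)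
    {j : ℕ} (hj : j ≤ d) : Mem (tR γ d n j) (tIv d S Dp j) := by
  unfold tR tIv
  apply mem_ivSum
  intro i hi
  have hi' : i ≤ j / 2 := Nat.lt_succ_iff.mp (mem_range.mp hi)
  rw [hDp i (le_trans hi' (Nat.div_le_div_right hj))]
  obtain ⟨⟨plo, phi⟩, pnn⟩ := deltaSq_pow_mem (γ := γ) hD hm i
  have hq : (0 : ℚ) ≤ qCoef d j i := by unfold qCoef; positivity
  have hq' : (0 : ℝ) ≤ (qCoef d j i : ℝ) := by exact_mod_cast hq
  have hp : Mem (gorttwDeltaSq γ (n + d) ^ i * (qCoef d j i : ℝ))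
      ((dPow D i).1 * qCoef d j i, (dPow D i).2 * qCoef d j i) := by
    constructor <;> push_cast
    · exact mul_le_mul_of_nonneg_right plo hq'
    · exact mul_le_mul_of_nonneg_right phi hq'
  exact mem_mulNS (mul_nonneg pnn hq) hp (hS _ (by omega))

end Cell

/-! ## The cell theorem -/

/-- An in-range lookup is a member of the list. -/
theorem lk_mem {win : List Iv} {t : ℕ} (ht : t < win.length) : lk win t ∈ win := by
  unfold lk
  rw [List.getD_eq_getElem?_getD, List.getElem?_eq_getElem ht, Option.getD_some]
  exact List.getElem_mem ht

/-- `absUb` is nonnegative. -/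
theorem absUb_nonneg (a : Iv) : 0 ≤ absUb a := le_max_of_le_left (abs_nonneg _)

/-- Lookups (with default `0`) in a list of nonnegative rationals are nonnegative. -/
theorem lk'_nonneg {L : List ℚ} (h : ∀ x ∈ L, 0 ≤ x) (j : ℕ) : 0 ≤ checkCell.lk' L j := by
  unfold checkCell.lk'
  rw [List.getD_eq_getElem?_getD]
  cases hj : L[j]? with
  | none => simp
  | some x => simpa using h x (List.mem_of_getElem? hj)

/-- **Soundness of the cell checker.** For any real sequence `γ` whose consecutive ratios on the window are enclosed,
`checkCell = true` with valid tables gives both weighted `ℓ¹` inequalities of the cell `(d, n)` of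
`XiGorttwCoeffSmallBelow rhoWinMin N` (`3 ≤ d < 108`). -/
theorem cellSmall_of_checkCell {γ : ℕ → ℝ} {d n : ℕ} {R : ℕ → ℚ} {s : ℚ} {win : List Iv}
    (hd3 : 3 ≤ d) (hd : d < 108) (hR : RValid d R) (hs : TValid d s)
    (hwin : ∀ t, t < d → Mem (γ (n + t + 1) / γ (n + t)) (lk win t))
    (hchk : checkCell d R (1 / (s + 1)) (sTab d) win = true) :
    (∑ j ∈ range d, |gorttwCoeff γ d n (j + 1)| * rhoWinMin d (j + 1) < 1) ∧
    (∑ j ∈ range d, |gorttwCoeff γ d n (j + 1)| * (2 / hermiteTestBound d) ^ (j + 1) < 1) := by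
  unfold checkCell at hchk
  simp only [Bool.and_eq_true, decide_eq_true_eq, List.all_eq_true] at hchk
  obtain ⟨⟨hlen, hpos⟩, hD, heo1, heo2⟩ := hchk
  set W := wList (lk win) d with hWdef
  set D : Iv := ((1 - (lk W 2).2) / 2, (1 - (lk W 2).1) / 2) with hDdef
  set S := (List.range (d + 1)).map (sIv d (sTab d) (lk W)) with hSdef
  set Dp := (List.range (d / 2 + 1)).map (dPow D) with hDpdef
  set U := (List.range (d + 1)).map (fun j => absUb (tIv d (lk S) (lk Dp) j)) with hUdef
  -- the window hypothesis
  have hW : WinEncl γ n d (lk win) := fun t ht => ⟨hpos _ (lk_mem (by omega)), hwin t ht⟩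
  have hWlk : ∀ i, i ≤ d → lk W i = wIv (lk win) d i := fun i hi => lk_map_range _ (by omega)
  have hDmem : Mem (gorttwDeltaSq γ (n + d)) D := deltaSq_mem hW (by omega) (hWlk 2 (by omega))
  have hΔsq : 0 < gorttwDeltaSq γ (n + d) := lt_of_lt_of_le (by exact_mod_cast hD) hDmem.1
  have hΔpos : 0 < gorttwDelta γ (n + d) := Real.sqrt_pos.mpr hΔsq
  have hδΔ : ((D.1 : ℚ) : ℝ) ≤ gorttwDelta γ (n + d) ^ 2 := by
    unfold gorttwDelta; rw [Real.sq_sqrt hΔsq.le]; exact hDmem.1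
  have hSmem : ∀ k, k ≤ d → Mem (sR γ d n k) (lk S k) := fun k hk => by
    rw [hSdef, lk_map_range _ (by omega)]; exact sR_mem_sIv hW (by omega) hWlk hk
  have hDp : ∀ i, i ≤ d / 2 → lk Dp i = dPow D i := fun i hi => by rw [hDpdef, lk_map_range _ (by omega)]
  have hTmem : ∀ j, j ≤ d → Mem (tR γ d n j) (tIv d (lk S) (lk Dp) j) := fun j hj =>
    tR_mem_tIv hD.le hDmem hSmem hDp hj
  have hM : γ (n + d) ≠ 0 := ne_zero_of_winEncl hW le_rfl (by omega)
  have hM1 : γ (n + d - 1) ≠ 0 := by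
    have := ne_zero_of_winEncl hW (show d - 1 ≤ d by omega) (by omega)
    rwa [show n + (d - 1) = n + d - 1 by omega] at this
  -- |c_j| ≤ U_j / Δ^j
  have hU : ∀ j, 1 ≤ j → j ≤ d →
      |gorttwCoeff γ d n j| ≤ (checkCell.lk' U j : ℝ) / gorttwDelta γ (n + d) ^ j := by
    intro j hj1 hjd
    rw [hUdef, lk'_map_range _ (by omega), le_div_iff₀ (pow_pos hΔpos j)]
    have := abs_le_absUb (hTmem j hjd)
    rwa [← gorttwCoeff_mul_delta_pow hjd hM hM1 hΔsq, abs_mul, abs_of_pos (pow_pos hΔpos j)] at this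
  have hU0 : ∀ j, j < d → 0 ≤ checkCell.lk' U (j + 1) := fun j _ =>
    lk'_nonneg (fun x hx => by
      rw [hUdef, List.mem_map] at hx
      obtain ⟨a, -, rfl⟩ := hx
      exact absUb_nonneg _) _
  have hR0 : ∀ j, j < d → 0 ≤ R (j + 1) := fun j hj => by
    have := (rhoHT_le_of_RValid hd3 hR (show 1 ≤ j + 1 by omega) (by omega)).2
    exact_mod_cast this
  obtain ⟨hs0, hs2⟩ := hs
  have ht0 : (0 : ℚ) ≤ 1 / (s + 1) := by positivity
  have ht0' : ∀ j, j < d → 0 ≤ (fun j => (1 / (s + 1)) ^ j) (j + 1) := fun j _ => pow_nonneg ht0 _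
  obtain ⟨hB0, hBt⟩ := two_div_testBound_le (d := d) ⟨hs0, hs2⟩
  constructor
  · calc ∑ j ∈ range d, |gorttwCoeff γ d n (j + 1)| * rhoWinMin d (j + 1)
        ≤ ∑ j ∈ range d, (checkCell.lk' U (j + 1) : ℝ) * (R (j + 1) : ℝ) / gorttwDelta γ (n + d) ^ (j + 1) := by
          refine Finset.sum_le_sum fun j hj => ?_
          have hj' := mem_range.mp hj
          obtain ⟨hρR, hR0'⟩ := rhoHT_le_of_RValid hd3 hR (show 1 ≤ j + 1 by omega) (by omega)
          calc |gorttwCoeff γ d n (j + 1)| * rhoWinMin d (j + 1)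
              ≤ |gorttwCoeff γ d n (j + 1)| * (R (j + 1) : ℝ) :=
                mul_le_mul_of_nonneg_left ((rhoWinMin_le_rhoHT hd _).trans hρR) (abs_nonneg _)
            _ ≤ (checkCell.lk' U (j + 1) : ℝ) / gorttwDelta γ (n + d) ^ (j + 1) * (R (j + 1) : ℝ) :=
                mul_le_mul_of_nonneg_right (hU (j + 1) (by omega) (by omega)) hR0'
            _ = _ := by ring
      _ ≤ _ := sum_le_ePart_add_oPart hU0 hR0 hD hΔpos hδΔ
      _ < 1 := ePart_add_oPart_lt_one hU0 hR0 hD hΔpos hδΔ heo1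
  · calc ∑ j ∈ range d, |gorttwCoeff γ d n (j + 1)| * (2 / hermiteTestBound d) ^ (j + 1)
        ≤ ∑ j ∈ range d, (checkCell.lk' U (j + 1) : ℝ) * (((1 / (s + 1)) ^ (j + 1) : ℚ) : ℝ) /
            gorttwDelta γ (n + d) ^ (j + 1) := by
          refine Finset.sum_le_sum fun j hj => ?_
          have hj' := mem_range.mp hj
          have hpow : (2 / hermiteTestBound d) ^ (j + 1) ≤ (((1 / (s + 1)) ^ (j + 1) : ℚ) : ℝ) := by
            push_cast
            have := pow_le_pow_left₀ hB0 hBt (j + 1)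
            push_cast at this
            exact this
          calc |gorttwCoeff γ d n (j + 1)| * (2 / hermiteTestBound d) ^ (j + 1)
              ≤ |gorttwCoeff γ d n (j + 1)| * (((1 / (s + 1)) ^ (j + 1) : ℚ) : ℝ) :=
                mul_le_mul_of_nonneg_left hpow (abs_nonneg _)
            _ ≤ (checkCell.lk' U (j + 1) : ℝ) / gorttwDelta γ (n + d) ^ (j + 1) *
                  (((1 / (s + 1)) ^ (j + 1) : ℚ) : ℝ) :=
                mul_le_mul_of_nonneg_right (hU (j + 1) (by omega) (by omega))
                  (by exact_mod_cast pow_nonneg ht0 (j + 1))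
            _ = _ := by ring
      _ ≤ _ := sum_le_ePart_add_oPart (wt := fun j => (1 / (s + 1)) ^ j) hU0 ht0' hD hΔpos hδΔ
      _ < 1 := ePart_add_oPart_lt_one (wt := fun j => (1 / (s + 1)) ^ j) hU0 ht0' hD hΔpos hδΔ heo2

end Summit.RiemannHypothesis.RiemannHypothesis.Theorems.JensenPolynomials.CoeffTable
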